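/-
Copyright (c) 2026 the pub-hodgecm-mathlib formalisation cell (harness21).  Prover seat hodgecm-mathlib-K2E4-p11 (g6), Track B ∕ K2-LIT, h413 = `stmt-HodgeConjecture-24833`,
line `K2_E1_TraceFormulaBeta`, campaign «5Res ENDGAME BY FAMILIES», ROADCARD §3′ D4′c (SD), dealer K2E1-plan (g7) deal (241): the LETTER ALGEBRA of the residue operators `R_c` of a
self-dual block — `hr` (simple poles of the entries), `hRsymm` (Hermitian), `hRpos` (non-negative) of ★ `exists_linearIsometry_selfDual_of_letters` — from entrywise data, from a real
non-negative quadratic form, and from a GRAM identity.  Mathlib only.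
-/
import Mathlib.Analysis.InnerProductSpace.PiL2
import Mathlib.Analysis.InnerProductSpace.Symmetric
import Mathlib.Analysis.Complex.RemovableSingularity
import Mathlib.LinearAlgebra.Matrix.ToLin
import HarnessLib

/-!
# D4′c (SD) LETTERS — `K2E1ResidueOperatorLettersOfGram`: the residue operators `R_c` of a finite-dimensional operator family `M(z)` at real points `c ∈ S` — EXISTENCE with `hr` from
# «`(z − c)·⟪v′, M(z)v⟫` bounded near `c`», and `hRsymm`∕`hRpos` from «`⟪v, R_c v⟫` real `≥ 0`» or from a GRAM IDENTITY `⟪v′, R_c v⟫ = κ·⟪ρ_c v′, ρ_c v⟫` (Mathlib only)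

Track B ∕ K2-LIT, crux h413 = `stmt-HodgeConjecture-24833`, route of record `HCCMUnconditional`; cell `hodgecm-mathlib`, squad K2, ENGINE E1; dealer K2E1-plan (g7) deal (241) («the UNOWNED
(SD) RESIDUE-OPERATOR LETTERS at M1 for ★ `exists_linearIsometry_selfDual_of_letters`: `hr` (SIMPLE poles of the matrix entries `z ↦ ⟪φ_b, M(z;χ)φ_a⟫` in (½,1] with residue operator
`R_c`), `hRsymm` (`R_c` Hermitian) and `hRpos` (`0 ≤ re ⟪v, R_c v⟫`) … (z−c)·E bounded near c ⇒ simple pole + L² residue ★ γ-pattern; R_c = Gram of L²-residues ⇒ Hermitian ≥ 0 —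
hypothesis-first»).  THEOREMS ONLY (no `def`, no `instance`, no `notation`, no `sorry`; default heartbeats); lane `--supports stmt-HodgeConjecture-24833 --as helper` (count-neutral).
ABSTRACT: `V` a finite-dimensional complex inner-product space (E1: `V(χ, K, 1)` at M1), `M : ℂ → V →ₗ[ℂ] V` (the intertwining operator `M(z; χ)` in coordinates), `S : Finset ℝ` (its real
poles in `(½, 1]`).  The consumer's letters (★ p860321 :123–:125) are the `φ a`, `φ b` instances of the conclusions below (which hold for ALL `v, v′ ∈ V`).

THE MATHEMATICS ([MoeglinWaldspurger1995, IV.1.11, IV.3.12]; [Langlands1976, §7, Lemma 7.5]; [Rudin1987, Thm 10.20 (Riemann)]).  (§1) ENTRYWISE ⇒ OPERATOR: on an orthonormal basis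
`e` of `V`, `⟪v′, M(z)v⟫ = Σ_{i,j} conj⟪e_i,v′⟫·⟪e_j,v⟫·⟪e_i, M(z)e_j⟫`; if each `(z − c)·⟪e_i, M(z)e_j⟫` is differentiable on a punctured neighbourhood of `c` and BOUNDED there, it
has a limit `L_{ij}(c)` (Riemann's removable singularity theorem, Mathlib `Complex.tendsto_limUnder_of_differentiable_on_punctured_nhds_of_bounded_under`) — i.e. the pole at `c` is AT
MOST SIMPLE — and the operator `R_c` with matrix `L(c)` (Mathlib `Matrix.toLin`) satisfies `(z − c)·⟪v′, M(z)v⟫ → ⟪v′, R_c v⟫` for all `v, v′`: the letter `hr`.  (§2) If `⟪v, R v⟫` is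
REAL and `≥ 0` for every `v`, then `R` is Hermitian (polarisation, Mathlib `LinearMap.isSymmetric_iff_inner_map_self_real`) and `0 ≤ re⟪v, Rv⟫`: the letters `hRsymm`, `hRpos` — the shape
paid by the Maass–Selberg residue identity at fixed `T`, `‖Λ^T u_v‖² = C·(⟪v, R_c v⟫ − T^{1−2c}∕(2c−1)·‖R_c v‖²)`.  (§3) GRAM ROAD: if the entry residues are `κ·⟪ρ_c v′, ρ_c v⟫_H` for
linear «residue maps» `ρ_c : V → H` into an inner-product space (E1: `v ↦ Res_{z=c} E(·, v) ∈ L²`) and `κ ≥ 0`, then `R_c` exists with `⟪v′, R_c v⟫ = κ⟪ρ_c v′, ρ_c v⟫` and all three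
letters hold.
* §0 `inner_apply_eq_sum_basis` (sesquilinear expansion on an orthonormal basis), `exists_linearMap_inner_basis_eq` (an operator with prescribed matrix), `tendsto_inner_apply_of_basis`.
* §1 `exists_tendsto_sub_mul_of_bounded` (scalar removable singularity), HEAD **`exists_residueOperator_of_entries`** (`hr` for all `v v′`, from entrywise differentiability + boundedness).
* §2 **`inner_symm_of_inner_self_real`**, **`hRsymm_hRpos_of_inner_self_real_nonneg`**.
* §3 HEAD **`exists_residueOperator_of_gram`** (`∃ R`, Gram formula ∧ `hr` ∧ `hRsymm` ∧ `hRpos`).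
HONEST LABEL: HC_CM is proved only modulo the 7 printed citations (2 remaining named inputs: hLiu418 = `stmt-HodgeConjecture-24832`, h413 = `stmt-HodgeConjecture-24833`) until rung 0
closes; this file asserts no named fact, closes no socket; count-neutral; letter-free, Mathlib-only; the ANALYTIC payments («`(z−c)`·entries bounded near `c`», the Gram ∕ fixed-`T`
residue identity) are the χ-twins of the (MS-real)₂ files β∕γ, dealt separately.

## References
* [MoeglinWaldspurger1995] C. Mœglin, J.-L. Waldspurger, *Spectral decomposition and Eisenstein series* (1995), IV.1.11, IV.3.12.
* [Langlands1976] R. P. Langlands, *On the Functional Equations Satisfied by Eisenstein Series*, LNM 544 (1976), §7.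
* [Rudin1987] W. Rudin, *Real and Complex Analysis* (3rd ed., 1987), Thm 10.20.
-/

set_option autoImplicit false
set_option linter.dupNamespace false  -- the mandated namespace repeats the summit's segment (`HodgeConjecture.HodgeConjecture`)

noncomputable section

open Filter Topology Complex
open scoped InnerProductSpace ComplexConjugate

namespace Summit.HodgeConjecture.HodgeConjecture.Cruxes.H413.K2E1ResidueOperatorLettersOfGram

variable {V : Type*} [NormedAddCommGroup V] [InnerProductSpace ℂ V]

/-! ## §0 Sesquilinear expansion on an orthonormal basis -/

section Basis

variable {ι : Type*} [Fintype ι]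

/-- `⟪v′, T v⟫ = Σ_i Σ_j conj⟪e_i, v′⟫ · (⟪e_j, v⟫ · ⟪e_i, T e_j⟫)` on an orthonormal basis `e`. [folklore] -/
theorem inner_apply_eq_sum_basis (e : OrthonormalBasis ι ℂ V) (T : V →ₗ[ℂ] V) (v v' : V) :
    ⟪v', T v⟫_ℂ = ∑ i, ∑ j, conj ⟪e i, v'⟫_ℂ * (⟪e j, v⟫_ℂ * ⟪e i, T (e j)⟫_ℂ) := by
  conv_lhs => rw [← e.sum_repr' v', ← e.sum_repr' v]
  rw [map_sum, sum_inner]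
  refine Finset.sum_congr rfl fun i _ => ?_
  rw [inner_sum]
  refine Finset.sum_congr rfl fun j _ => ?_
  rw [map_smul, inner_smul_left, inner_smul_right]

/-- `⟪A v′, A v⟫ = Σ_i Σ_j conj⟪e_i, v′⟫ · (⟪e_j, v⟫ · ⟪A e_i, A e_j⟫)` for a linear `A : V → H` (the Gram expansion). [folklore] -/
theorem inner_map_map_eq_sum_basis {H : Type*} [NormedAddCommGroup H] [InnerProductSpace ℂ H] (e : OrthonormalBasis ι ℂ V) (A : V →ₗ[ℂ] H) (v v' : V) :
    ⟪A v', A v⟫_ℂ = ∑ i, ∑ j, conj ⟪e i, v'⟫_ℂ * (⟪e j, v⟫_ℂ * ⟪A (e i), A (e j)⟫_ℂ) := by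
  conv_lhs => rw [← e.sum_repr' v', ← e.sum_repr' v]
  rw [map_sum, map_sum, sum_inner]
  refine Finset.sum_congr rfl fun i _ => ?_
  rw [inner_sum]
  refine Finset.sum_congr rfl fun j _ => ?_
  rw [map_smul, map_smul, inner_smul_left, inner_smul_right]

/-- An operator with prescribed matrix `⟪e_i, T e_j⟫ = L i j` on an orthonormal basis (Mathlib `Matrix.toLin`). [folklore] -/
theorem exists_linearMap_inner_basis_eq [DecidableEq ι] (e : OrthonormalBasis ι ℂ V) (L : ι → ι → ℂ) :
    ∃ T : V →ₗ[ℂ] V, ∀ i j, ⟪e i, T (e j)⟫_ℂ = L i j := by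
  refine ⟨Matrix.toLin e.toBasis e.toBasis (Matrix.of fun i j => L i j), fun i j => ?_⟩
  have h := Matrix.toLin_self (v₁ := e.toBasis) (v₂ := e.toBasis) (Matrix.of fun i j => L i j) j
  simp only [OrthonormalBasis.coe_toBasis, Matrix.of_apply] at h
  rw [h, inner_sum]
  simp_rw [inner_smul_right, orthonormal_iff_ite.1 e.orthonormal, mul_ite, mul_one, mul_zero]
  rw [Finset.sum_ite_eq]
  simp only [Finset.mem_univ, if_true]

/-- **Entrywise limits on a basis give the limit for all pairs**: if `g(z)·⟪e_i, M(z)e_j⟫ → ⟪e_i, T e_j⟫` for all `i, j`, then `g(z)·⟪v′, M(z)v⟫ → ⟪v′, T v⟫`. [folklore] -/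
theorem tendsto_inner_apply_of_basis (e : OrthonormalBasis ι ℂ V) {l : Filter ℂ} (g : ℂ → ℂ) (M : ℂ → V →ₗ[ℂ] V) (T : V →ₗ[ℂ] V)
    (h : ∀ i j, Tendsto (fun z => g z * ⟪e i, M z (e j)⟫_ℂ) l (𝓝 ⟪e i, T (e j)⟫_ℂ)) (v v' : V) :
    Tendsto (fun z => g z * ⟪v', M z v⟫_ℂ) l (𝓝 ⟪v', T v⟫_ℂ) := by
  have hexp : (fun z => g z * ⟪v', M z v⟫_ℂ) = fun z => ∑ i, ∑ j, conj ⟪e i, v'⟫_ℂ * (⟪e j, v⟫_ℂ * (g z * ⟪e i, M z (e j)⟫_ℂ)) := by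
    funext z
    rw [inner_apply_eq_sum_basis e (M z) v v', Finset.mul_sum]
    refine Finset.sum_congr rfl fun i _ => ?_
    rw [Finset.mul_sum]
    refine Finset.sum_congr rfl fun j _ => ?_
    ring
  rw [hexp, inner_apply_eq_sum_basis e T v v']
  exact tendsto_finsetSum _ fun i _ => tendsto_finsetSum _ fun j _ => ((h i j).const_mul _).const_mul _

end Basis

/-! ## §1 `hr`: residue operators from entrywise «differentiable + `(z − c)`·entry bounded» near each `c ∈ S` -/

section Entries

/-- **Scalar removable singularity**: `m` differentiable on a punctured neighbourhood of `c` with `(z − c)·m(z)` BOUNDED there ⟹ `(z − c)·m(z)` has a limit at `c` (at most a simple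
pole). [cite: Rudin1987, Thm 10.20] -/
theorem exists_tendsto_sub_mul_of_bounded {m : ℂ → ℂ} {c : ℂ} (hd : ∀ᶠ z in 𝓝[≠] c, DifferentiableAt ℂ m z)
    (hb : ∃ C : ℝ, ∀ᶠ z in 𝓝[≠] c, ‖(z - c) * m z‖ ≤ C) :
    ∃ L : ℂ, Tendsto (fun z => (z - c) * m z) (𝓝[≠] c) (𝓝 L) := by
  obtain ⟨C, hC⟩ := hb
  refine ⟨_, tendsto_limUnder_of_differentiable_on_punctured_nhds_of_bounded_under
    (hd.mono fun z hz => ((differentiableAt_id.sub (differentiableAt_const c)).mul hz)) ⟨C, ?_⟩⟩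
  simpa only [sub_self, zero_mul, sub_zero, Filter.eventually_map] using hC

/-- **HEAD (`hr`) — RESIDUE OPERATORS FROM ENTRYWISE DATA.**  `V` finite-dimensional, `M : ℂ → End V`, `S` a finite set of real points.  IF every entry `z ↦ ⟪v′, M(z)v⟫` is
differentiable on a punctured neighbourhood of each `c ∈ S` and `(z − c)·⟪v′, M(z)v⟫` is BOUNDED there, THEN there are operators `R_c` with
`(z − c)·⟪v′, M(z)v⟫ → ⟪v′, R_c v⟫` (`z → c`, `z ≠ c`) for ALL `v, v′` — the poles on `S` are at most simple, with residue operator `R_c`. [cite: MoeglinWaldspurger1995, IV.1.11]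
[cite: Langlands1976, §7] -/
theorem exists_residueOperator_of_entries [FiniteDimensional ℂ V] (M : ℂ → V →ₗ[ℂ] V) (S : Finset ℝ)
    (hsd : ∀ v v' : V, ∀ c ∈ S, ∀ᶠ z in 𝓝[≠] (c : ℂ), DifferentiableAt ℂ (fun z => ⟪v', M z v⟫_ℂ) z)
    (hbd : ∀ v v' : V, ∀ c ∈ S, ∃ C : ℝ, ∀ᶠ z in 𝓝[≠] (c : ℂ), ‖(z - c) * ⟪v', M z v⟫_ℂ‖ ≤ C) :
    ∃ R : ℝ → V →ₗ[ℂ] V, ∀ v v' : V, ∀ c ∈ S, Tendsto (fun z : ℂ => (z - c) * ⟪v', M z v⟫_ℂ) (𝓝[≠] (c : ℂ)) (𝓝 ⟪v', R c v⟫_ℂ) := by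
  classical
  set e := stdOrthonormalBasis ℂ V
  have hL : ∀ c : ℝ, ∃ T : V →ₗ[ℂ] V, c ∈ S → ∀ i j,
      Tendsto (fun z : ℂ => (z - c) * ⟪e i, M z (e j)⟫_ℂ) (𝓝[≠] (c : ℂ)) (𝓝 ⟪e i, T (e j)⟫_ℂ) := by
    intro c
    by_cases hc : c ∈ S
    · have hlim : ∀ i j, ∃ L : ℂ, Tendsto (fun z : ℂ => (z - c) * ⟪e i, M z (e j)⟫_ℂ) (𝓝[≠] (c : ℂ)) (𝓝 L) := fun i j =>
        exists_tendsto_sub_mul_of_bounded (hsd (e j) (e i) c hc) (hbd (e j) (e i) c hc)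
      choose L hL using hlim
      obtain ⟨T, hT⟩ := exists_linearMap_inner_basis_eq e L
      exact ⟨T, fun _ i j => by rw [hT]; exact hL i j⟩
    · exact ⟨0, fun h => absurd h hc⟩
  choose R hR using hL
  exact ⟨R, fun v v' c hc => tendsto_inner_apply_of_basis e (fun z : ℂ => z - c) M (R c) (hR c hc) v v'⟩

end Entries

/-! ## §2 `hRsymm`, `hRpos`: from «`⟪v, R v⟫` real and non-negative» (polarisation) -/

section Quadratic

/-- **A complex operator whose quadratic form is REAL is Hermitian** (polarisation; Mathlib `LinearMap.isSymmetric_iff_inner_map_self_real`). [folklore] -/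
theorem inner_symm_of_inner_self_real (R : V →ₗ[ℂ] V) (hreal : ∀ v : V, (⟪v, R v⟫_ℂ).im = 0) (v v' : V) : ⟪v, R v'⟫_ℂ = ⟪R v, v'⟫_ℂ := by
  have hsym : R.IsSymmetric := by
    refine (LinearMap.isSymmetric_iff_inner_map_self_real R).2 fun w => ?_
    have h1 : conj ⟪R w, w⟫_ℂ = ⟪w, R w⟫_ℂ := inner_conj_symm w (R w)
    have h2 : conj ⟪w, R w⟫_ℂ = ⟪w, R w⟫_ℂ := Complex.conj_eq_iff_im.2 (hreal w)
    rw [h1, ← inner_conj_symm (R w) w, h2]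
  exact (hsym v v').symm

/-- **`hRsymm` AND `hRpos` FROM A REAL NON-NEGATIVE QUADRATIC FORM**: if `⟪v, R_c v⟫` is real and `≥ 0` for every `v` (`c ∈ S`), then `R_c` is Hermitian and `0 ≤ re⟪v, R_c v⟫` — the
consumer's letters verbatim.  (The shape paid by the Maass–Selberg residue identity at fixed `T`: `‖Λ^T u_v‖² = C·(⟪v, R_c v⟫ − T^{1−2c}∕(2c−1)·‖R_c v‖²)`, `C > 0`, `c > ½`.)
[cite: MoeglinWaldspurger1995, IV.3.12] [cite: Langlands1976, §7] -/
theorem hRsymm_hRpos_of_inner_self_real_nonneg (R : ℝ → V →ₗ[ℂ] V) (S : Finset ℝ)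
    (hreal : ∀ c ∈ S, ∀ v : V, (⟪v, R c v⟫_ℂ).im = 0) (hnn : ∀ c ∈ S, ∀ v : V, 0 ≤ (⟪v, R c v⟫_ℂ).re) :
    (∀ c ∈ S, ∀ v v' : V, ⟪v, R c v'⟫_ℂ = ⟪R c v, v'⟫_ℂ) ∧ (∀ c ∈ S, ∀ v : V, 0 ≤ RCLike.re ⟪v, R c v⟫_ℂ) :=
  ⟨fun c hc v v' => inner_symm_of_inner_self_real (R c) (hreal c hc) v v', fun c hc v => by rw [RCLike.re_to_complex]; exact hnn c hc v⟩

end Quadratic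

/-! ## §3 The GRAM road: `⟪v′, R_c v⟫ = κ·⟪ρ_c v′, ρ_c v⟫` ⟹ `hr`, `hRsymm`, `hRpos` -/

section Gram

/-- **HEAD — RESIDUE OPERATORS FROM A GRAM IDENTITY.**  `V` finite-dimensional, `M : ℂ → End V`, `S ⊂ ℝ` finite, `κ ≥ 0`, linear «residue maps» `ρ_c : V → H` into a complex
inner-product space (E1: `v ↦ Res_{z=c} E(·, v)` in `L²`).  IF `(z − c)·⟪v′, M(z)v⟫ → κ·⟪ρ_c v′, ρ_c v⟫` (`z → c`, `z ≠ c`) for all `v, v′` and `c ∈ S`, THEN there are operators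
`R_c` (`= κ·ρ_c^† ρ_c`) with `⟪v′, R_c v⟫ = κ·⟪ρ_c v′, ρ_c v⟫`, and the three letters of ★ `exists_linearIsometry_selfDual_of_letters` hold for all `v, v′`: `hr` (simple poles with
residue `R_c`), `hRsymm` (Hermitian), `hRpos` (`re ⟪v, R_c v⟫ = κ‖ρ_c v‖² ≥ 0`). [cite: MoeglinWaldspurger1995, IV.3.12] [cite: Langlands1976, §7, Lemma 7.5] -/
theorem exists_residueOperator_of_gram [FiniteDimensional ℂ V] {H : Type*} [NormedAddCommGroup H] [InnerProductSpace ℂ H] (M : ℂ → V →ₗ[ℂ] V) (S : Finset ℝ)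
    (κ : ℝ) (hκ : 0 ≤ κ) (ρ : ℝ → V →ₗ[ℂ] H)
    (hres : ∀ v v' : V, ∀ c ∈ S, Tendsto (fun z : ℂ => (z - c) * ⟪v', M z v⟫_ℂ) (𝓝[≠] (c : ℂ)) (𝓝 ((κ : ℂ) * ⟪ρ c v', ρ c v⟫_ℂ))) :
    ∃ R : ℝ → V →ₗ[ℂ] V, (∀ (c : ℝ) (v v' : V), ⟪v', R c v⟫_ℂ = (κ : ℂ) * ⟪ρ c v', ρ c v⟫_ℂ) ∧
      (∀ v v' : V, ∀ c ∈ S, Tendsto (fun z : ℂ => (z - c) * ⟪v', M z v⟫_ℂ) (𝓝[≠] (c : ℂ)) (𝓝 ⟪v', R c v⟫_ℂ)) ∧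
      (∀ c ∈ S, ∀ v v' : V, ⟪v, R c v'⟫_ℂ = ⟪R c v, v'⟫_ℂ) ∧ (∀ c ∈ S, ∀ v : V, 0 ≤ RCLike.re ⟪v, R c v⟫_ℂ) := by
  classical
  set e := stdOrthonormalBasis ℂ V
  have hT : ∀ c : ℝ, ∃ T : V →ₗ[ℂ] V, ∀ i j, ⟪e i, T (e j)⟫_ℂ = (κ : ℂ) * ⟪ρ c (e i), ρ c (e j)⟫_ℂ := fun c =>
    exists_linearMap_inner_basis_eq e _
  choose R hR using hT
  have hgram : ∀ (c : ℝ) (v v' : V), ⟪v', R c v⟫_ℂ = (κ : ℂ) * ⟪ρ c v', ρ c v⟫_ℂ := by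
    intro c v v'
    rw [inner_apply_eq_sum_basis e (R c) v v', inner_map_map_eq_sum_basis e (ρ c) v v', Finset.mul_sum]
    refine Finset.sum_congr rfl fun i _ => ?_
    rw [Finset.mul_sum]
    refine Finset.sum_congr rfl fun j _ => ?_
    rw [hR c i j]
    ring
  have him0 : ∀ (c : ℝ) (v : V), (⟪ρ c v, ρ c v⟫_ℂ).im = 0 := fun c v => by
    rw [← RCLike.im_to_complex]; exact inner_self_im (ρ c v)
  have hre0 : ∀ (c : ℝ) (v : V), (⟪ρ c v, ρ c v⟫_ℂ).re = ‖ρ c v‖ ^ 2 := fun c v => by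
    rw [← RCLike.re_to_complex]; exact inner_self_eq_norm_sq (ρ c v)
  obtain ⟨hsymm, hpos⟩ := hRsymm_hRpos_of_inner_self_real_nonneg R S
    (fun c _ v => by rw [hgram, Complex.mul_im, Complex.ofReal_re, Complex.ofReal_im, him0, mul_zero, zero_mul, add_zero])
    (fun c _ v => by rw [hgram, Complex.mul_re, Complex.ofReal_re, Complex.ofReal_im, zero_mul, sub_zero, hre0]; positivity)
  exact ⟨R, hgram, fun v v' c hc => by rw [hgram]; exact hres v v' c hc, hsymm, hpos⟩

end Gram

end Summit.HodgeConjecture.HodgeConjecture.Cruxes.H413.K2E1ResidueOperatorLettersOfGram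

end
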